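import Summits.AtomisticToContinuum.Crystallization.Theorems.FrustratedLawDichotomyStrainedPatchHomLeafTableParamB

/-!
# Param-form leaf — soundness readings: `finalP` unpacked, the penalty tables `ANt / AEM / GzM / wM`, `penE` read in `ℝ`

decomp-a2c hand-1 g23 (crux `AperiodicFrustratedLawGap`, stmt-AtomisticToContinuum-27623; critic row 882).  Small proof-side readings used by
`…HomLeafTableSoundP.leafCheckP_sound`: ★ `finalP_true`, the table forms `ANt` (n-class constants), `AEM` (E-coefficient of an entry), `GzM` (signed
entry gradient `Σ_c c_ac H_cb`), `wM` (entry widths), ★ `penE_cast` (the kernel penalty `penE` IS `Σ_ab (|GzM| + E·AEM)·wM`), `wM_cast`.  0 sorry; standard axioms.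
`--supports stmt-AtomisticToContinuum-27623`.
-/

noncomputable section

namespace Summit.AtomisticToContinuum.Crystallization.Theorems.FrustratedLawDichotomyStrainedPatchHomLeafTableCheck

open scoped BigOperators
open Literature.Analysis.ValidatedNumerics.Numerics

/-! ## §1. Small readings -/

/-- Unpacking `finalP`. [formal bookkeeping] -/
theorem finalP_true {E A0 A1 A2 A3 A4 A5 ANd ANo : ℕ} {k : LK} {e : EP} {sμ : Bool} {aμ : ℕ} {a : Acc}
    (h : finalP E A0 A1 A2 A3 A4 A5 ANd ANo k e sμ aμ a = true) :
    a.ok = true ∧ lhs E (addP sμ aμ 0) (gradPen E A0 A1 A2 A3 A4 A5 k a) a + 2 * penE E ANd ANo e a ≤ rhs (addN sμ aμ 0) a := by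
  unfold finalP lhsP at h
  simp only [Bool.and_eq_true, Nat.ble_eq, Nat.add_eq, Nat.mul_eq] at h
  exact h

/-- The `n`-class constant table `AN c b` (`ANd` on the diagonal, `ANo` off it). -/
def ANt (ANd ANo : ℕ) (c b : Fin 3) : ℕ := if c = b then ANd else ANo

/-- The `E`-coefficient of the kernel penalty for entry `(aa, bb)`. -/
def AEM (ANd ANo : ℕ) (e : EP) (aa bb : Fin 3) : ℕ :=
  (![e.c00, e.c10, e.c20] aa).natAbs * ANt ANd ANo 0 bb + (![e.c01, e.c11, e.c21] aa).natAbs * ANt ANd ANo 1 bb +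
    (![e.c02, e.c12, e.c22] aa).natAbs * ANt ANd ANo 2 bb

/-- The signed kernel gradient for entry `(aa, bb)`: `Σ_c c_(aa,c) H_(c,bb)`. -/
def GzM (e : EP) (a : Acc) (aa bb : Fin 3) : ℤ :=
  ![e.c00, e.c10, e.c20] aa * Hm a 0 bb + ![e.c01, e.c11, e.c21] aa * Hm a 1 bb + ![e.c02, e.c12, e.c22] aa * Hm a 2 bb

/-- The kernel widths table. -/
def wM (e : EP) (aa bb : Fin 3) : ℕ := ![![e.w00, e.w01, e.w02], ![e.w10, e.w11, e.w12], ![e.w20, e.w21, e.w22]] aa bb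

/-- `penE` read in `ℝ` through the tables. [formal bookkeeping] -/
theorem penE_cast (E ANd ANo : ℕ) (e : EP) (a : Acc) :
    ((penE E ANd ANo e a : ℕ) : ℝ) = ∑ aa : Fin 3, ∑ bb : Fin 3, ((((GzM e a aa bb).natAbs + E * AEM ANd ANo e aa bb) * wM e aa bb : ℕ) : ℝ) := by
  simp only [Fin.sum_univ_three]
  simp only [penE, penTerm, rowDot, rowAbsDot, GzM, AEM, ANt, wM, Hm, Nat.add_eq, Nat.mul_eq, Int.add_def, Int.mul_def,
    Matrix.cons_val_zero, Matrix.cons_val_one, Matrix.cons_val_two, Matrix.head_cons, Matrix.tail_cons, Fin.isValue]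
  norm_num
  push_cast
  ring

/-- The entry record's widths read in `ℝ`. [formal bookkeeping] -/
theorem wM_cast {w : Fin 3 × Fin 3 → ℤ} (c : Fin 3 × Fin 3 → ℤ) (hw : ∀ ab, 0 ≤ w ab) (aa bb : Fin 3) :
    ((wM (epOf c w) aa bb : ℕ) : ℝ) = (w (aa, bb) : ℝ) := by
  have e : ∀ ab, (((w ab).toNat : ℕ) : ℝ) = ((w ab : ℤ) : ℝ) := fun ab => by exact_mod_cast Int.toNat_of_nonneg (hw ab)
  fin_cases aa <;> fin_cases bb <;> simp [wM, epOf, e]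

end Summit.AtomisticToContinuum.Crystallization.Theorems.FrustratedLawDichotomyStrainedPatchHomLeafTableCheck

end
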